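import Summits.Ventures.LatticeQCDFlow.Scaling.ReplicaExchangeFrozenCold
import Summits.Ventures.LatticeQCDFlow.Scaling.SimulatedTemperingMixingTime

/-!
HONEST FRAMING: exact (Metropolis-corrected) sampling algorithms for lattice gauge theory; figures
of merit are autocorrelation/cost numbers at stated couplings and volumes; no continuum-physics
claim.

# ReplicaExchangeModeMixingTime — MIXING TIME OF LAZY REPLICA EXCHANGE FROM A COLD START, WITHOUT THE COLD REPLICAS'
# BARRIER CROSSING: `t_mix(lazy ptBareSampler ½ μ M; ε) ≤ ⌈(2/c)(½(K+1)log(1/m) + log(1/(2ε)))⌉` WITH `c` THE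
# CHAPTER-R GAP FLOOR (`pq^Kγ_A·min{δ₂/K², γ₀/(K+1)}/(96(K+1)²)`, OR `pq^K·min{1/K², γ₀/(K+1)}/(96(K+1)²)` FOR
# ARBITRARY COLD UPDATES) AND `m ≤ μ_k(x)` (lean-2 GEN-18, ours)

Venture-side (OURS).  Cell `lqcd-flow` (pub-lqcd), unit `pub-lqcd-lean-2-g18`, 2026-08-25.  Chapter R, file 7 — the
replica-exchange counterpart of `Scaling/SimulatedTemperingMixingTime` (GEN-17, W3), whose generic bridge
`mixingTime_lazyVersion_le_of_gap` (Levin–Peres Thm 12.4 + Exercise 12.3, PROVED in the Literature) is applied to the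
chapter-R gap floors of `Scaling/ReplicaExchangeModeGap` / `Scaling/ReplicaExchangeFrozenCold`; `π̃_min ≥ m^{K+1}`.

## What is proved

* `tensorFun_ge_pow` — `m ≤ μ_k(x)` ⇒ `m^{K+1} ≤ π̃(x)`.
* **`ptBareMode_mixingTime_le`** — with within-mode gaps `γ_A`, the hot replica's global gap `γ₀`, assignment-restricted
  swap overlaps `δ₂`, persistence `p`, cooling `q`, irreducible reversible replica updates:
  `t_mix(lazy; ε) ≤ ⌈(2/c)(½log(1/m^{K+1}) + log(1/(2ε)))⌉`, `c = pq^Kγ_A·min{δ₂/K², γ₀/(K+1)}/(96(K+1)²)`.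
* **`ptBareFrozen_mixingTime_le`** — the same with `c = pq^K·min{1/K², γ₀/(K+1)}/(96(K+1)²)` for ARBITRARY reversible
  cold updates (irreducible hot update, pointwise two-sided persistence).

NOT CLAIMED: the non-lazy sampler; lower bounds (`Scaling/TemperingMixingTimeFloor` gives them from the torpid
ceilings); anything measured.  Literature grade (cell rule): TEXTBOOK bridge + chapter R floors; NEW TYPING; no new bib
keys.
-/

noncomputable section

open Finset Function
open Literature.Probability.MarkovChains
open Literature.Probability.MarkovChains.Decomposition

namespace Summit.Ventures.LatticeQCDFlow.Scaling

section Mixing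

variable {S J : Type*} [Fintype S] [DecidableEq S] [Fintype J] [DecidableEq J] {K : ℕ}
  {μ : Fin (K + 1) → S → ℝ} {M : Fin (K + 1) → S → S → ℝ} {mode : S → J}

omit [Fintype S] [DecidableEq S] [Fintype J] [DecidableEq J] in
/-- A uniform lower bound `0 ≤ m ≤ μ_k(x)` gives `π̃(x) ≥ m^{K+1}`. [ours] -/
theorem tensorFun_ge_pow {m : ℝ} (hm0 : 0 ≤ m) (hm : ∀ k x, m ≤ μ k x) (x : Fin (K + 1) → S) :
    m ^ (K + 1) ≤ tensorFun μ x := by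
  unfold tensorFun
  calc m ^ (K + 1) = ∏ _k : Fin (K + 1), m := by rw [Finset.prod_const, Finset.card_univ, Fintype.card_fin]
    _ ≤ ∏ k, μ k (x k) := Finset.prod_le_prod (fun _ _ => hm0) fun k _ => hm k (x k)

/-- **MIXING TIME OF LAZY REPLICA EXCHANGE WITHOUT THE COLD REPLICAS' BARRIER CROSSING** (`t = ½`, `K ≥ 1`):
`t_mix(lazy ptBareSampler; ε) ≤ ⌈(2/c)(½log(1/m^{K+1}) + log(1/(2ε)))⌉`, `c = pq^Kγ_A·min{δ₂/K², γ₀/(K+1)}/(96(K+1)²)`.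
[ours] -/
theorem ptBareMode_mixingTime_le [Nontrivial S] (hμ : ∀ k x, 0 < μ k x) (hμ1 : ∀ k, ∑ x, μ k x = 1)
    (hmode : Function.Surjective mode) (hK : 1 ≤ K) (hM : ∀ k, IsRowStochastic (M k))
    (hMrev : ∀ k, DetailedBalance (μ k) (M k)) (hMirr : ∀ k, IsIrreducible (M k))
    {p q δ₂ γ₀ γA : ℝ} (hp : 0 < p) (hp1 : p ≤ 1) (hq0 : 0 < q) (hq1 : q ≤ 1) (hδ0 : 0 < δ₂) (hδ1 : δ₂ ≤ 1)
    (hγ₀ : 0 < γ₀) (hγA : 0 < γA) (hγA1 : γA ≤ 1)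
    (hpers : ∀ (i k : Fin (K + 1)) (j : J), i ≤ k → p * blockMass (μ k) mode j ≤ blockMass (μ i) mode j)
    (hq : ∀ (l : Fin K) (j : J), q * blockMass (μ l.castSucc) mode j ≤ blockMass (μ l.succ) mode j)
    (hδ : ∀ (m : Fin (K + 1) → J) (l : Fin K), m ∘ levelSwap l ≠ m →
      δ₂ * min (blockMass (tensorFun μ) (fun z : Fin (K + 1) → S => mode ∘ z) m)
          (blockMass (tensorFun μ) (fun z : Fin (K + 1) → S => mode ∘ z) (m ∘ levelSwap l))
        ≤ ∑ x ∈ block (fun z : Fin (K + 1) → S => mode ∘ z) m, min (tensorFun μ x) (tensorFun μ (x ∘ levelSwap l)))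
    (hgap0 : ∀ h : S → ℝ, γ₀ * lawVariance (μ 0) h ≤ dirichletForm (μ 0) (M 0) h)
    (hgapA : ∀ k j, ∀ h : S → ℝ, γA * lawVariance (blockLaw (μ k) mode j) h
      ≤ dirichletForm (blockLaw (μ k) mode j) (restrictionChain (M k) mode) h)
    {m : ℝ} (hm0 : 0 < m) (hm : ∀ k x, m ≤ μ k x) {ε : ℝ} (hε : 0 < ε) (hε2 : ε ≤ 1 / 2) :
    mixingTime (lazyVersion (ptBareSampler (1 / 2) μ M)) (tensorFun μ) ε
      ≤ ⌈2 / (p * q ^ K * γA * min (δ₂ / K ^ 2) (γ₀ / (K + 1)) / (96 * (K + 1) ^ 2))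
          * (Real.log (1 / m ^ (K + 1)) / 2 + Real.log (1 / (2 * ε)))⌉₊ := by
  have ht0 : (0 : ℝ) < 1 / 2 := by norm_num
  have ht1 : (1 / 2 : ℝ) < 1 := by norm_num
  have hKr : (1 : ℝ) ≤ K := by exact_mod_cast hK
  have hc : 0 < p * q ^ K * γA * min (δ₂ / K ^ 2) (γ₀ / (K + 1)) / (96 * (K + 1) ^ 2) := by
    have : 0 < min (δ₂ / K ^ 2) (γ₀ / (K + 1)) := lt_min (div_pos hδ0 (by positivity)) (div_pos hγ₀ (by positivity))
    positivity
  exact mixingTime_lazyVersion_le_of_gap (tensorFun_pos hμ) (sum_tensorFun_eq_one μ hμ1)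
    (ptBareSampler_isRowStochastic hμ hM ht0.le ht1.le) (ptBareSampler_detailedBalance hμ hMrev)
    (ptBareSampler_isIrreducible hμ hM hMirr ht0.le ht1) hc
    (ptBareModeHalf_spectralGap_ge_of_hotGap hμ hμ1 hmode hK hM hMrev hp hp1 hq0 hq1 hδ0 hδ1 hγ₀ hγA hγA1 hpers hq
      hδ hgap0 hgapA)
    (πmin := m ^ (K + 1)) (by positivity) (tensorFun_ge_pow hm0.le hm) hε hε2

/-- **THE SAME FOR ARBITRARY COLD UPDATES** (irreducible hot update with gap `γ₀`, pointwise two-sided persistence):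
`t_mix(lazy ptBareSampler; ε) ≤ ⌈(2/c)(½log(1/m^{K+1}) + log(1/(2ε)))⌉`, `c = pq^K·min{1/K², γ₀/(K+1)}/(96(K+1)²)`.
[ours] -/
theorem ptBareFrozen_mixingTime_le [Nontrivial S] (hμ : ∀ k x, 0 < μ k x) (hμ1 : ∀ k, ∑ x, μ k x = 1)
    (hK : 1 ≤ K) (hM : ∀ k, IsRowStochastic (M k)) (hMrev : ∀ k, DetailedBalance (μ k) (M k))
    (hM0 : IsIrreducible (M 0)) {p q γ₀ : ℝ} (hp : 0 < p) (hp1 : p ≤ 1) (hq0 : 0 < q) (hq1 : q ≤ 1) (hγ₀ : 0 < γ₀)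
    (hpers : ∀ (i k : Fin (K + 1)) (x : S), i ≤ k → p * μ k x ≤ μ i x)
    (hq : ∀ (l : Fin K) (x : S), q * μ l.castSucc x ≤ μ l.succ x)
    (hgap0 : ∀ h : S → ℝ, γ₀ * lawVariance (μ 0) h ≤ dirichletForm (μ 0) (M 0) h)
    {m : ℝ} (hm0 : 0 < m) (hm : ∀ k x, m ≤ μ k x) {ε : ℝ} (hε : 0 < ε) (hε2 : ε ≤ 1 / 2) :
    mixingTime (lazyVersion (ptBareSampler (1 / 2) μ M)) (tensorFun μ) ε
      ≤ ⌈2 / (p * q ^ K * min (1 / (K : ℝ) ^ 2) (γ₀ / (K + 1)) / (96 * (K + 1) ^ 2))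
          * (Real.log (1 / m ^ (K + 1)) / 2 + Real.log (1 / (2 * ε)))⌉₊ := by
  have ht0 : (0 : ℝ) < 1 / 2 := by norm_num
  have ht1 : (1 / 2 : ℝ) < 1 := by norm_num
  have hKr : (1 : ℝ) ≤ K := by exact_mod_cast hK
  have hc : 0 < p * q ^ K * min (1 / (K : ℝ) ^ 2) (γ₀ / (K + 1)) / (96 * (K + 1) ^ 2) := by
    have : 0 < min (1 / (K : ℝ) ^ 2) (γ₀ / (K + 1)) := lt_min (by positivity) (div_pos hγ₀ (by positivity))
    positivity
  exact mixingTime_lazyVersion_le_of_gap (tensorFun_pos hμ) (sum_tensorFun_eq_one μ hμ1)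
    (ptBareSampler_isRowStochastic hμ hM ht0.le ht1.le) (ptBareSampler_detailedBalance hμ hMrev)
    (ptBareSampler_isIrreducible_of_hot hμ hM hM0 ht0 ht1) hc
    (ptBareFrozen_spectralGap_ge hK hμ hμ1 hM hMrev hp hp1 hq0 hq1 hγ₀ hpers hq hgap0)
    (πmin := m ^ (K + 1)) (by positivity) (tensorFun_ge_pow hm0.le hm) hε hε2

end Mixing

end Summit.Ventures.LatticeQCDFlow.Scaling
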